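import Literature.NumberTheory.GaloisRepresentations.LocalUnramifiedBrauerCyclic
import HarnessLib

/-!
# The Brauer group of a local field is locally cyclic (Serre, *Corps locaux* XIII §3 Cor. 3)

For a non-archimedean local field `F` of characteristic `0` and a finite `E ⊆ F̄` with absolute
Galois group `Γ_E = Gal(F̄/E) ≤ Γ_F` (`galFixing F E`), any two classes
`x, y ∈ Br(E) = H²(Γ_E, F̄ˣ)` lie in a common cyclic subgroup (`exists_mem_zmultiples_pair`).
Proof: both die on `Γ_{L₀}` for some finite Galois `L₀/F` containing `E` (classes of a profinite
group are locally trivial, `exists_nhds_resH_two_eq_zero`); inside the frame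
`L₁ = L₀ F_m`, `m = [L₀ : E] f_E`, the group `Br(L₀/E)` is cyclic
(`exists_resKer_eq_zmultiples`), and `H²(Γ_E, F̄ˣ)` in the subgroup model `galFixing F E` is
identified with `H²` of the frame subgroup `layerN L₁ D_E` (the same subgroup of `Γ_F`) by the
restriction maps in both directions (`resSub_resSub`, `resSub_self`).

Consequently every subgroup of `Br(E)` of bounded exponent is cyclic; this is the input
`dim H²(Γ_E, μ_p) ≤ 1` of local Tate duality.

## References
* J.-P. Serre, *Corps locaux*, Hermann, 1968, XIII §3 Cor. 3 (`Br(K) = ∪ Br(K_n/K) ≅ ℚ/ℤ`). [SerreLocalFields1979]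
* J.-P. Serre, *Galois Cohomology*, Springer, 1997, I §2.2 Prop. 8. [SerreGaloisCohomology1997]
-/

noncomputable section

open CategoryTheory Function
open Field IsNonarchimedeanLocalField ValuativeRel IntermediateField

universe u

namespace Literature.NumberTheory.GaloisRepresentations

open _root_.TopRep _root_.ContRepresentation _root_.ContinuousCohomology DiscreteGaloisModule
open _root_.Topology _root_.Filter
open LocalWeilDatum

/-! ### Classes of `H²` are locally trivial -/

section LocallyTrivial

variable {Γ : Type u} [Group Γ] [TopologicalSpace Γ] [IsTopologicalGroup Γ]
variable {A : Type u} [AddCommGroup A] [TopologicalSpace A] [DiscreteTopology A]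

/-- **Every class of `H²(Γ, A)` restricts to zero on all small open subgroups** (class form of the
tree's cochain-level `exists_nhds_one_res_two_eq_d`). [cite: SerreGaloisCohomology1997, I §2.2 Prop. 8] -/
theorem exists_nhds_resH_two_eq_zero [CompactSpace Γ] (ρ : ContinuousRep Γ ℤ A)
    (z : continuousCohomology 2 ρ.toTopRep) :
    ∃ V ∈ 𝓝 (1 : Γ), ∀ U : Subgroup Γ, (U : Set Γ) ⊆ V → resH U ρ 2 z = 0 := by
  obtain ⟨a, ha, rfl⟩ := cxClass_surjective (homogeneousCochains ρ.toTopRep) 2 3 up_nat_next_two z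
  obtain ⟨V, hV, h⟩ := exists_nhds_one_res_two_eq_d ρ a
  refine ⟨V, hV, fun U hU => ?_⟩
  obtain ⟨b, hb⟩ := h U hU
  unfold resH ContinuousCohomology.map
  rw [homologyMap_cxClass _ 2 3 up_nat_next_two a ha _ (by rw [hom_f_d_apply, ha, map_zero]) rfl,
    cxClass_eq_zero_iff _ 2 3 up_nat_next_two 1 up_nat_prev_two]
  exact ⟨b, hb⟩

end LocallyTrivial

/-! ### Galois correspondence helpers -/

section GaloisCorr

variable (F : Type u) [Field F] [CharZero F]

/-- **`Gal(F̄/L) ≤ Gal(F̄/E)` implies `E ≤ L`** (characteristic `0`). [folklore] -/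
theorem le_of_galFixing_le [ValuativeRel F] [TopologicalSpace F] [IsNonarchimedeanLocalField F]
    {E L : IntermediateField F (AlgebraicClosure F)}
    (h : galFixing F L ≤ galFixing F E) : E ≤ L := by
  intro x hx
  have hmem := coe_mem_of_forall_galFixing_smul F (le_sepClosure_of_charZero F L)
    (x := ⟨x, le_sepClosure_of_charZero F E hx⟩) (fun σ hσ => (mem_galFixing_iff F).1 (h hσ) x hx)
  exact hmem

/-- **Injectivity of `E ↦ Gal(F̄/E)`** (characteristic `0`). [folklore] -/
theorem eq_of_galFixing_eq [ValuativeRel F] [TopologicalSpace F] [IsNonarchimedeanLocalField F]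
    {E L : IntermediateField F (AlgebraicClosure F)}
    (h : galFixing F E = galFixing F L) : E = L :=
  le_antisymm (le_of_galFixing_le F h.ge) (le_of_galFixing_le F h.le)

end GaloisCorr

/-! ### Local cyclicity of `Br(E)` -/

section Local

variable (F : Type u) [Field F] [ValuativeRel F] [TopologicalSpace F] [IsNonarchimedeanLocalField F]
  [CharZero F]

attribute [local instance] compactSpace_of_isClosed_subgroup isClosed_layerN

omit [ValuativeRel F] [TopologicalSpace F] [IsNonarchimedeanLocalField F] [CharZero F] in
/-- `Gal(F̄/E)` is closed (instance form). [folklore] -/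
theorem isClosed_galFixing' (E : IntermediateField F (AlgebraicClosure F)) :
    IsClosed ((galFixing F E : Subgroup (absoluteGaloisGroup F)) : Set (absoluteGaloisGroup F)) :=
  isClosed_galFixing F E

attribute [local instance] isClosed_galFixing'

/-- **Any two classes of `Br(E) = H²(Gal(F̄/E), F̄ˣ)` lie in a common cyclic subgroup**, for `E`
finite over the non-archimedean local field `F` of characteristic `0`: see the module docstring.
[cite: SerreLocalFields1979, XIII §3 Prop. 7 and Cor. 3] -/
theorem exists_mem_zmultiples_pair (E : IntermediateField F (AlgebraicClosure F)) [FiniteDimensional F E]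
    (x y : continuousCohomology 2 ((units F).restrict (subgroupIncl (galFixing F E))).toTopRep) :
    ∃ u : continuousCohomology 2 ((units F).restrict (subgroupIncl (galFixing F E))).toTopRep,
      x ∈ AddSubgroup.zmultiples u ∧ y ∈ AddSubgroup.zmultiples u := by
  classical
  -- Step 1: a finite Galois `L₀ ⊇ E` on whose group both classes die
  obtain ⟨Vx, hVx, hx⟩ := exists_nhds_resH_two_eq_zero ((units F).restrict (subgroupIncl (galFixing F E))) x
  obtain ⟨Vy, hVy, hy⟩ := exists_nhds_resH_two_eq_zero ((units F).restrict (subgroupIncl (galFixing F E))) y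
  obtain ⟨Wx, hWx, hWVx⟩ := (mem_nhds_subtype _ (1 : galFixing F E) Vx).1 hVx
  obtain ⟨Wy, hWy, hWVy⟩ := (mem_nhds_subtype _ (1 : galFixing F E) Vy).1 hVy
  obtain ⟨L₀, hfin, hgal, hL₀⟩ := exists_finiteDimensional_isGalois_galFixing_subset (k := F)
    (inter_mem (inter_mem hWx hWy) ((isOpen_galFixing F E).mem_nhds (galFixing F E).one_mem))
  haveI := hfin
  haveI := hgal
  have hL₀S : galFixing F L₀ ≤ galFixing F E := fun σ hσ => (hL₀ hσ).2
  have hEL₀ : E ≤ L₀ := le_of_galFixing_le F hL₀S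
  have hmap : ((galFixing F L₀).subgroupOf (galFixing F E)).map (galFixing F E).subtype = galFixing F L₀ :=
    Subgroup.map_subgroupOf_eq_of_le hL₀S
  have hresx : resSub (units F) hL₀S 2 x = 0 := by
    rw [← resSub_eq_zero_congr (units F) hmap (map_subtype_le' _) hL₀S, resSub_eq_zero_iff_resH_eq_zero]
    exact hx _ (fun s hs => hWVx (hL₀ hs).1.1)
  have hresy : resSub (units F) hL₀S 2 y = 0 := by
    rw [← resSub_eq_zero_congr (units F) hmap (map_subtype_le' _) hL₀S, resSub_eq_zero_iff_resH_eq_zero]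
    exact hy _ (fun s hs => hWVy (hL₀ hs).1.2)
  -- Step 2: the frame `L₁ = L₀ F_m`, `m = [L₀ : E] f_E`
  obtain ⟨N, hNdef⟩ : ∃ N : ℕ, N = (galFixing F L₀).relIndex (galFixing F E) := ⟨_, rfl⟩
  have hN0 : N ≠ 0 := by
    intro h0
    have h1 := Subgroup.relIndex_mul_index hL₀S
    rw [← hNdef, h0, zero_mul] at h1
    have h2 : (galFixing F L₀).index ≠ 0 := by
      rw [← ker_resGal, Subgroup.index_ker]
      exact Nat.card_pos.ne'
    exact h2 h1.symm
  obtain ⟨m, hmdef⟩ : ∃ m : ℕ, m = N * fDeg F E := ⟨_, rfl⟩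
  have hm : 0 < m := hmdef ▸ Nat.mul_pos (Nat.pos_of_ne_zero hN0) (fDeg_pos F E)
  haveI := (unramifiedLevel_finite_abelian_unramified F hm).1
  haveI := (unramifiedLevel_finite_abelian_unramified F hm).2.1
  let L₁ : IntermediateField F (AlgebraicClosure F) := L₀ ⊔ unramifiedLevel F m
  haveI : FiniteDimensional F L₁ := IntermediateField.finiteDimensional_sup L₀ _
  haveI : IsGalois F L₁ := isGalois_iff.2 ⟨inferInstance, inferInstance⟩
  have hEL₁ : E ≤ L₁ := hEL₀.trans le_sup_left
  have hmL : unramifiedLevel F m ≤ L₁ := le_sup_right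
  let D : Subgroup (L₁ ≃ₐ[F] L₁) := (galFixing F E).map (resGal L₁)
  let D_L : Subgroup (L₁ ≃ₐ[F] L₁) := (galFixing F L₀).map (resGal L₁)
  have hDE : layerN L₁ D = galFixing F E := by
    change ((galFixing F E).map (resGal L₁)).comap (resGal L₁) = galFixing F E
    rw [Subgroup.comap_map_eq_self]
    rw [ker_resGal]
    exact galFixing_antitone F hEL₁
  have hDL' : layerN L₁ D_L = galFixing F L₀ := by
    change ((galFixing F L₀).map (resGal L₁)).comap (resGal L₁) = galFixing F L₀
    rw [Subgroup.comap_map_eq_self]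
    rw [ker_resGal]
    exact galFixing_antitone F le_sup_left
  have hDL : D_L ≤ D := Subgroup.map_mono hL₀S
  haveI : (galFixing F L₀).Normal := normal_galFixing L₀
  haveI : D_L.Normal := Subgroup.Normal.map inferInstance _ (resGal_surjective L₁)
  have hn : (D_L.subgroupOf D).Normal := inferInstance
  have hfield : fieldOf F L₁ D = E := by
    apply eq_of_galFixing_eq F
    rw [← layerN_eq_galFixing, hDE]
  have hrel : D_L.relIndex D = N := by
    rw [hNdef, ← hDE, ← hDL']
    change _ = (D_L.comap (resGal L₁)).relIndex (D.comap (resGal L₁))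
    rw [Subgroup.relIndex_comap, Subgroup.map_comap_eq_self_of_surjective (resGal_surjective L₁)]
  have hmK : m = D_L.relIndex D * fDeg F (fieldOf F L₁ D) := by
    rw [hrel, hfield, hmdef]
  -- Step 3: `Br(L₀/E)` is cyclic in the frame
  obtain ⟨u', hker, -, -⟩ := exists_resKer_eq_zmultiples F hDL hn hm hmL hmK
  -- Step 4: transport along `layerN L₁ D = Gal(F̄/E)`
  have hx' : resSub (units F) hDE.le 2 x ∈ resKer (units F) (layerN'_le L₁ hDL) := by
    rw [mem_resKer, resSub_resSub, resSub_eq_zero_congr (units F) hDL' _ hL₀S]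
    exact hresx
  have hy' : resSub (units F) hDE.le 2 y ∈ resKer (units F) (layerN'_le L₁ hDL) := by
    rw [mem_resKer, resSub_resSub, resSub_eq_zero_congr (units F) hDL' _ hL₀S]
    exact hresy
  rw [hker, AddSubgroup.mem_zmultiples_iff] at hx' hy'
  obtain ⟨i, hi⟩ := hx'
  obtain ⟨j, hj⟩ := hy'
  refine ⟨resSub (units F) hDE.ge 2 u', ?_, ?_⟩
  · refine AddSubgroup.mem_zmultiples_iff.2 ⟨i, ?_⟩
    rw [← map_zsmul, hi, resSub_resSub]
    exact resSub_self (units F) (galFixing F E) 2 x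
  · refine AddSubgroup.mem_zmultiples_iff.2 ⟨j, ?_⟩
    rw [← map_zsmul, hj, resSub_resSub]
    exact resSub_self (units F) (galFixing F E) 2 y

end Local

end Literature.NumberTheory.GaloisRepresentations

end
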